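import Summits.CriticalPhenomena.PercolationContinuityZ3.Theorems.PercNearOneGluingNoHeavyLowerTailSahiMixtureLaw
import Summits.CriticalPhenomena.PercolationContinuityZ3.Theorems.PercNearOneGluingNoHeavyLowerTailSahiMixtureThreeCell

/-!
# Sahi positivity under mixtures (law level), II: the SQUARE-FREE CELLS over a pair and over a triple of events — explicit nonnegative
# Bernstein forms of `E_2`, `E_3` of every OR- and AND-mixture of an independent coin

Support file of the one-cut programme (crux `NoHeavyLowerTail`, stmt-CriticalPhenomena-4575; cell `prim-masterthm`, seat P3, gen 5;
`run/shared/lean/prim/prim-masterthm/prim-masterthm-p3/HIERARCHY.md` §12).  Vocabulary: `…SahiMixtureLaw` (`coinWeight`, `orCoin`, `andCoin`,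
`BernsteinPos`), `…SahiMixtureThreeCell` (`cov_inter_add_sdiff_nonneg`, the replay of ttrl cp-mix's exact certificate `QA_qT_cert_deg3_p2`).
Assembled into the theorem "the mixture conjecture holds for three events" in `…SahiMixtureLawThree`.

With `x_i = μ(A_i)`, `x_{ij} = μ(A_i ∩ A_j)`, `x_{012}`, `E_3`, `g = 1 − h`, the cells are (this seat's exact symbolic derivation, `code/mixcells.py`;
cp-mix MIXCOMB.md §2 for the `|F| = 2` OR cell), each a manifestly nonnegative Bernstein form given `Cov(A_i,A_j) ≥ 0`, `E_3 ≥ 0`: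
* pairs (`bernsteinPos_two_orCoin`, `bernsteinPos_two_andCoin`): OR `Cov_h = g·Cov` (one member mixed), `g·(g·Cov + h·μ(Ā_iĀ_j))` (both);
  AND `h·Cov`, `h g·x_{ij} + h²·Cov`;
* OR triple (`bernsteinPos_three_orCoin`, eight patterns): one member mixed `g·E_3 + h·Cov(other two)`; two members `i,j` mixed
  `g²·E_3 + h g·T_k`, `T_k = Cov(1_{A_iA_j},1_{A_k}) + μ(A_k ∖ (A_i∪A_j)) ≥ 0` (`mixT_nonneg` — THE ONE GENUINE CERTIFICATE, from
  `cov_inter_add_sdiff_nonneg`; needs `Cov(A_i,A_k) ≥ 0` and `E_3 ≥ 0`); all three mixed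
  `g³·E_3 + h g²·[E_3 + μ(at most one A_i) + ∏_i μ(Ā_i)] + h² g·μ(at most one A_i)` (kit job j096142 of this seat first found `c_1 − E_3` as a
  101-term polynomial with positive integer coefficients in the Venn-cell masses; it collapses to this closed form);
* AND triple (`bernsteinPos_three_andCoin`): one mixed `h·E_3`; two mixed (`i,j`): `h g·[E_3 + x_i·Cov(A_j,A_k) + x_j·x_{ik}] + h²·E_3`; all three
  `2 h g²·x_{012} + h² g·[2E_3 + Σ_k x_k·Cov(A_i,A_j) + x_0x_1x_2] + h³·E_3`.
HONEST FRAMING: cells of three events only; nothing general is claimed. [this work]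
-/

noncomputable section

open scoped Classical

namespace Summit.CriticalPhenomena.PercolationContinuityZ3.Theorems

open Finset Function
open Literature.Combinatorics.Sahi2008
open Literature.Probability.Percolation.BHK2006 (ind_inter ind_le_one)
open Literature.Probability.Percolation.DecisionTree (ind ind_of_mem ind_of_not_mem ind_nonneg)
open SahiComb

namespace SahiMixture

variable {α : Type*} [Fintype α]

/-! ### Small Bernstein certificates and linearity of moments -/

/-- `(1−h)²`. [folklore] -/
theorem bp_g2 : BernsteinPos 2 (fun h : ℝ => (1 - h) ^ 2) := (bernsteinPos_pow 0 2).congr fun h _ _ => by ring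
/-- `h(1−h)`. [folklore] -/
theorem bp_hg : BernsteinPos 2 (fun h : ℝ => h * (1 - h)) := (bernsteinPos_pow 1 1).congr fun h _ _ => by ring
/-- `h²`. [folklore] -/
theorem bp_h2 : BernsteinPos 2 (fun h : ℝ => h ^ 2) := (bernsteinPos_pow 2 0).congr fun h _ _ => by ring
/-- `(1−h)³`. [folklore] -/
theorem bp_g3 : BernsteinPos 3 (fun h : ℝ => (1 - h) ^ 3) := (bernsteinPos_pow 0 3).congr fun h _ _ => by ring
/-- `h(1−h)²`. [folklore] -/
theorem bp_hg2 : BernsteinPos 3 (fun h : ℝ => h * (1 - h) ^ 2) := (bernsteinPos_pow 1 2).congr fun h _ _ => by ring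
/-- `h²(1−h)`. [folklore] -/
theorem bp_h2g : BernsteinPos 3 (fun h : ℝ => h ^ 2 * (1 - h)) := (bernsteinPos_pow 2 1).congr fun h _ _ => by ring
/-- `h³`. [folklore] -/
theorem bp_h3 : BernsteinPos 3 (fun h : ℝ => h ^ 3) := (bernsteinPos_pow 3 0).congr fun h _ _ => by ring

/-- Linearity of `ex` against an explicit finite expansion. [folklore] -/
theorem ex_eq_lin (μ : α → ℝ) (f : α → ℝ) {k : ℕ} (c : Fin k → ℝ) (g : Fin k → α → ℝ)
    (hf : ∀ a, f a = ∑ i, c i * g i a) : ex μ f = ∑ i, c i * ex μ (g i) := by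
  simp only [ex_def, Finset.mul_sum]
  rw [Finset.sum_comm]
  exact Finset.sum_congr rfl fun a _ => by
    rw [hf a, Finset.mul_sum]
    exact Finset.sum_congr rfl fun i _ => by ring

/-! ### Coin moments of the mixture indicators -/

section Moments

variable (μ : α → ℝ) (h : ℝ)

/-- First coin moment of an OR-mixture indicator. [this work] -/
theorem exc_or₁ (hμ1 : ∑ a, μ a = 1) (X : Set α) (b : Bool) :
    ex (coinWeight μ h) (ind (orCoin X b)) = (1 - h) * ex μ (ind X) + h * (bif b then 1 else ex μ (ind X)) := by
  rw [ex_coinWeight]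
  cases b <;> simp [ex_const hμ1]

/-- Second coin moment of OR-mixture indicators. [this work] -/
theorem exc_or₂ (X Y : Set α) (b b' : Bool) :
    ex (coinWeight μ h) (ind (orCoin X b) * ind (orCoin Y b')) =
      (1 - h) * ex μ (ind X * ind Y) + h * ex μ ((bif b then 1 else ind X) * (bif b' then 1 else ind Y)) := by
  rw [ex_coinWeight]
  congr 2 <;> (congr 1; funext a; cases b <;> cases b' <;> simp)

/-- Third coin moment of OR-mixture indicators. [this work] -/
theorem exc_or₃ (X Y Z : Set α) (b b' b'' : Bool) :
    ex (coinWeight μ h) (ind (orCoin X b) * ind (orCoin Y b') * ind (orCoin Z b'')) =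
      (1 - h) * ex μ (ind X * ind Y * ind Z)
        + h * ex μ ((bif b then 1 else ind X) * (bif b' then 1 else ind Y) * (bif b'' then 1 else ind Z)) := by
  rw [ex_coinWeight]
  congr 2 <;> (congr 1; funext a; cases b <;> cases b' <;> cases b'' <;> simp)

/-- First coin moment of an AND-mixture indicator. [this work] -/
theorem exc_and₁ (X : Set α) (b : Bool) :
    ex (coinWeight μ h) (ind (andCoin X b)) = (1 - h) * (bif b then 0 else ex μ (ind X)) + h * ex μ (ind X) := by
  rw [ex_coinWeight]
  cases b <;> simp [ex_def]

/-- Second coin moment of AND-mixture indicators. [this work] -/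
theorem exc_and₂ (X Y : Set α) (b b' : Bool) :
    ex (coinWeight μ h) (ind (andCoin X b) * ind (andCoin Y b')) =
      (1 - h) * ex μ ((bif b then 0 else ind X) * (bif b' then 0 else ind Y)) + h * ex μ (ind X * ind Y) := by
  rw [ex_coinWeight]
  congr 2 <;> (congr 1; funext a; cases b <;> cases b' <;> simp)

/-- Third coin moment of AND-mixture indicators. [this work] -/
theorem exc_and₃ (X Y Z : Set α) (b b' b'' : Bool) :
    ex (coinWeight μ h) (ind (andCoin X b) * ind (andCoin Y b') * ind (andCoin Z b'')) =
      (1 - h) * ex μ ((bif b then 0 else ind X) * (bif b' then 0 else ind Y) * (bif b'' then 0 else ind Z))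
        + h * ex μ (ind X * ind Y * ind Z) := by
  rw [ex_coinWeight]
  congr 2 <;> (congr 1; funext a; cases b <;> cases b' <;> cases b'' <;> simp)

/-- `E_μ[0] = 0`. [folklore] -/
theorem ex_zero_fun : ex μ (0 : α → ℝ) = 0 := by simp [ex_def]

end Moments

/-! ### The square-free cells over a pair -/

section Pair

variable {μ : α → ℝ} (hμ : ∀ a, 0 ≤ μ a) (hμ1 : ∑ a, μ a = 1) (X Y : Set α)
  (hXY : ex μ (ind X) * ex μ (ind Y) ≤ ex μ (ind X * ind Y))
include hμ hμ1 hXY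

/-- **OR-mixture, pairs**: `Cov_h` is Bernstein-positive of degree `2` (`g·Cov`, or `g(g·Cov + h·μ(X̄Ȳ))` when both are mixed). [this work] -/
theorem bernsteinPos_two_orCoin (b b' : Bool) :
    BernsteinPos 2 (fun h => sahiE (coinWeight μ h) 2 ![ind (orCoin X b), ind (orCoin Y b')]) := by
  have hC : 0 ≤ ex μ (ind X * ind Y) - ex μ (ind X) * ex μ (ind Y) := sub_nonneg.2 hXY
  have hD : 0 ≤ 1 - ex μ (ind X) - ex μ (ind Y) + ex μ (ind X * ind Y) := by
    have h0 : 0 ≤ ex μ (fun a => (1 - ind X a) * (1 - ind Y a)) :=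
      ex_nonneg hμ fun a => mul_nonneg (sub_nonneg.2 (ind_le_one X a)) (sub_nonneg.2 (ind_le_one Y a))
    have e := ex_eq_lin μ (fun a => (1 - ind X a) * (1 - ind Y a)) ![1, -1, -1, 1] ![fun _ => 1, ind X, ind Y, ind X * ind Y]
      (fun a => by simp [Fin.sum_univ_succ]; ring)
    simp only [Fin.sum_univ_succ, Fin.sum_univ_zero, Matrix.cons_val_zero, Matrix.cons_val_succ, ex_const hμ1] at e
    linarith
  cases b <;> cases b'
  · refine (bernsteinPos_const 2 hC).congr fun h _ _ => ?_
    rw [sahiE_two, exc_or₂, exc_or₁ μ h hμ1, exc_or₁ μ h hμ1]; simp only [cond_false]; ring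
  · refine ((bernsteinPos_affine hC le_rfl).mono (by norm_num)).congr fun h _ _ => ?_
    rw [sahiE_two, exc_or₂, exc_or₁ μ h hμ1, exc_or₁ μ h hμ1]; simp only [cond_false, cond_true, mul_one]; ring
  · refine ((bernsteinPos_affine hC le_rfl).mono (by norm_num)).congr fun h _ _ => ?_
    rw [sahiE_two, exc_or₂, exc_or₁ μ h hμ1, exc_or₁ μ h hμ1]; simp only [cond_false, cond_true, one_mul]; ring
  · refine (((bp_g2.smul hC).add (bp_hg.smul hD))).congr fun h _ _ => ?_
    rw [sahiE_two, exc_or₂, exc_or₁ μ h hμ1, exc_or₁ μ h hμ1]; simp only [cond_true, one_mul, ex_one hμ1]; ring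

omit hμ1 in
/-- **AND-mixture, pairs**: `Cov_h = h·Cov`, or `h g·μ(XY) + h²·Cov` when both are mixed. [this work] -/
theorem bernsteinPos_two_andCoin (b b' : Bool) :
    BernsteinPos 2 (fun h => sahiE (coinWeight μ h) 2 ![ind (andCoin X b), ind (andCoin Y b')]) := by
  have hC : 0 ≤ ex μ (ind X * ind Y) - ex μ (ind X) * ex μ (ind Y) := sub_nonneg.2 hXY
  have hP : 0 ≤ ex μ (ind X * ind Y) := ex_nonneg hμ fun a => mul_nonneg (ind_nonneg X a) (ind_nonneg Y a)
  cases b <;> cases b'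
  · refine (bernsteinPos_const 2 hC).congr fun h _ _ => ?_
    rw [sahiE_two, exc_and₂, exc_and₁, exc_and₁]; simp only [cond_false]; ring
  · refine ((bernsteinPos_affine le_rfl hC).mono (by norm_num)).congr fun h _ _ => ?_
    rw [sahiE_two, exc_and₂, exc_and₁, exc_and₁]; simp only [cond_false, cond_true, mul_zero, ex_zero_fun]; ring
  · refine ((bernsteinPos_affine le_rfl hC).mono (by norm_num)).congr fun h _ _ => ?_
    rw [sahiE_two, exc_and₂, exc_and₁, exc_and₁]; simp only [cond_false, cond_true, zero_mul, ex_zero_fun]; ring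
  · refine ((bp_hg.smul hP).add (bp_h2.smul hC)).congr fun h _ _ => ?_
    rw [sahiE_two, exc_and₂, exc_and₁, exc_and₁]; simp only [cond_true, zero_mul, ex_zero_fun]; ring

end Pair

/-! ### The square-free cells over a triple -/

section Triple

variable {μ : α → ℝ} (hμ : ∀ a, 0 ≤ μ a) (hμ1 : ∑ a, μ a = 1) (X Y Z : Set α)
  (hXY : ex μ (ind X) * ex μ (ind Y) ≤ ex μ (ind X * ind Y))
  (hXZ : ex μ (ind X) * ex μ (ind Z) ≤ ex μ (ind X * ind Z))
  (hYZ : ex μ (ind Y) * ex μ (ind Z) ≤ ex μ (ind Y * ind Z))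
  (hE3 : 0 ≤ sahiE μ 3 ![ind X, ind Y, ind Z])
include hμ hμ1

omit hμ in
/-- The mixing inequality `T ≥ 0` of `…SahiMixtureThreeCell`, in product-moment form: mixing the coin into `X, Y` against `Z`. [this work;
certificate ttrl cp-mix] -/
theorem mixT_nonneg (hμ : ∀ a, 0 ≤ μ a) (hXZ : ex μ (ind X) * ex μ (ind Z) ≤ ex μ (ind X * ind Z))
    (hE3 : 0 ≤ sahiE μ 3 ![ind X, ind Y, ind Z]) :
    0 ≤ 2 * ex μ (ind X * ind Y * ind Z) - ex μ (ind X * ind Y) * ex μ (ind Z) - ex μ (ind X * ind Z) - ex μ (ind Y * ind Z)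
      + ex μ (ind Z) := by
  have hCov : ex μ (ind X) * ex μ (ind Z) ≤ ex μ (ind (X ∩ Z)) := by
    have e : ind (X ∩ Z) = ind X * ind Z := funext fun a => by simp only [Pi.mul_apply, ind_inter]
    rw [e]; exact hXZ
  have key := cov_inter_add_sdiff_nonneg μ hμ hμ1 X Y Z hCov hE3
  have e3 : ex μ (ind (X ∩ Y ∩ Z)) = ex μ (ind X * ind Y * ind Z) := by
    congr 1; funext a; simp only [Pi.mul_apply, ind_inter]
  have e2 : ex μ (ind (X ∩ Y)) = ex μ (ind X * ind Y) := by
    congr 1; funext a; simp only [Pi.mul_apply, ind_inter]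
  have ed : ex μ (ind (Z \ (X ∪ Y))) = ex μ (ind Z) - ex μ (ind X * ind Z) - ex μ (ind Y * ind Z) + ex μ (ind X * ind Y * ind Z) := by
    have e := ex_eq_lin μ (ind (Z \ (X ∪ Y))) ![1, -1, -1, 1] ![ind Z, ind X * ind Z, ind Y * ind Z, ind X * ind Y * ind Z]
      (fun a => by rw [ind_sdiff_union]; simp [Fin.sum_univ_succ]; ring)
    simp only [Fin.sum_univ_succ, Fin.sum_univ_zero, Matrix.cons_val_zero, Matrix.cons_val_succ] at e
    linarith
  rw [e3, e2, ed] at key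
  linarith

include hXY hXZ hYZ hE3

/-- **OR-mixture, triples**: `E_3` of the mixed triple is Bernstein-positive of degree `3`, for each of the eight mixing patterns. [this work] -/
theorem bernsteinPos_three_orCoin (bX bY bZ : Bool) :
    BernsteinPos 3 (fun h => sahiE (coinWeight μ h) 3 ![ind (orCoin X bX), ind (orCoin Y bY), ind (orCoin Z bZ)]) := by
  -- the moments and their ranges
  have x0 : 0 ≤ ex μ (ind X) := ex_nonneg hμ (ind_nonneg X)
  have y0 : 0 ≤ ex μ (ind Y) := ex_nonneg hμ (ind_nonneg Y)
  have z0 : 0 ≤ ex μ (ind Z) := ex_nonneg hμ (ind_nonneg Z)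
  have x1 : ex μ (ind X) ≤ 1 := (ex_mono hμ (ind_le_one X)).trans_eq (ex_one hμ1)
  have y1 : ex μ (ind Y) ≤ 1 := (ex_mono hμ (ind_le_one Y)).trans_eq (ex_one hμ1)
  have z1 : ex μ (ind Z) ≤ 1 := (ex_mono hμ (ind_le_one Z)).trans_eq (ex_one hμ1)
  have hCXY : 0 ≤ ex μ (ind X * ind Y) - ex μ (ind X) * ex μ (ind Y) := sub_nonneg.2 hXY
  have hCXZ : 0 ≤ ex μ (ind X * ind Z) - ex μ (ind X) * ex μ (ind Z) := sub_nonneg.2 hXZ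
  have hCYZ : 0 ≤ ex μ (ind Y * ind Z) - ex μ (ind Y) * ex μ (ind Z) := sub_nonneg.2 hYZ
  have hE3' : 0 ≤ 2 * ex μ (ind X * ind Y * ind Z) + ex μ (ind X) * ex μ (ind Y) * ex μ (ind Z)
      - (ex μ (ind X) * ex μ (ind Y * ind Z) + ex μ (ind Y) * ex μ (ind X * ind Z) + ex μ (ind Z) * ex μ (ind X * ind Y)) := by
    rw [sahiE_three] at hE3; exact hE3
  -- symmetric instances of `E_3 ≥ 0`, and the three mixing inequalities
  have hE3_XZY : 0 ≤ sahiE μ 3 ![ind X, ind Z, ind Y] := by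
    rw [sahiE_three, mul_right_comm (ind X) (ind Z) (ind Y), mul_comm (ind Z) (ind Y)]; linarith
  have hE3_YZX : 0 ≤ sahiE μ 3 ![ind Y, ind Z, ind X] := by
    rw [sahiE_three, mul_right_comm (ind Y) (ind Z) (ind X), mul_comm (ind Y) (ind X), mul_comm (ind Z) (ind X)]
    linarith
  have hTZ := mixT_nonneg hμ1 X Y Z hμ hXZ hE3
  have hTY : 0 ≤ 2 * ex μ (ind X * ind Y * ind Z) - ex μ (ind X * ind Z) * ex μ (ind Y) - ex μ (ind X * ind Y)
      - ex μ (ind Y * ind Z) + ex μ (ind Y) := by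
    have h := mixT_nonneg hμ1 X Z Y hμ hXY hE3_XZY
    rw [mul_right_comm (ind X) (ind Z) (ind Y), mul_comm (ind Z) (ind Y)] at h; exact h
  have hTX : 0 ≤ 2 * ex μ (ind X * ind Y * ind Z) - ex μ (ind Y * ind Z) * ex μ (ind X) - ex μ (ind X * ind Y)
      - ex μ (ind X * ind Z) + ex μ (ind X) := by
    have hYX : ex μ (ind Y) * ex μ (ind X) ≤ ex μ (ind Y * ind X) := by rw [mul_comm, mul_comm (ind Y)]; exact hXY
    have h := mixT_nonneg hμ1 Y Z X hμ hYX hE3_YZX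
    rw [mul_right_comm (ind Y) (ind Z) (ind X), mul_comm (ind Y) (ind X), mul_comm (ind Z) (ind X)] at h
    linarith
  -- `μ(at most one of X, Y, Z)` and `∏ μ(complements)`
  have hA1 : 0 ≤ 1 - (ex μ (ind X * ind Y) + ex μ (ind X * ind Z) + ex μ (ind Y * ind Z)) + 2 * ex μ (ind X * ind Y * ind Z) := by
    have h0 : 0 ≤ ex μ (fun a => (1 - ind X a) * (1 - ind Y a) * (1 - ind Z a) + ind X a * (1 - ind Y a) * (1 - ind Z a)
        + (1 - ind X a) * ind Y a * (1 - ind Z a) + (1 - ind X a) * (1 - ind Y a) * ind Z a) :=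
      ex_nonneg hμ fun a => by
        have := ind_nonneg X a; have := ind_nonneg Y a; have := ind_nonneg Z a
        have := ind_le_one X a; have := ind_le_one Y a; have := ind_le_one Z a
        have h1 : 0 ≤ (1 - ind X a) := by linarith
        have h2 : 0 ≤ (1 - ind Y a) := by linarith
        have h3 : 0 ≤ (1 - ind Z a) := by linarith
        positivity
    have e := ex_eq_lin μ (fun a => (1 - ind X a) * (1 - ind Y a) * (1 - ind Z a) + ind X a * (1 - ind Y a) * (1 - ind Z a)
        + (1 - ind X a) * ind Y a * (1 - ind Z a) + (1 - ind X a) * (1 - ind Y a) * ind Z a)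
      ![1, -1, -1, -1, 2] ![fun _ => 1, ind X * ind Y, ind X * ind Z, ind Y * ind Z, ind X * ind Y * ind Z]
      (fun a => by simp [Fin.sum_univ_succ]; ring)
    simp only [Fin.sum_univ_succ, Fin.sum_univ_zero, Matrix.cons_val_zero, Matrix.cons_val_succ, ex_const hμ1] at e
    linarith
  have hPN : 0 ≤ (1 - ex μ (ind X)) * (1 - ex μ (ind Y)) * (1 - ex μ (ind Z)) :=
    mul_nonneg (mul_nonneg (sub_nonneg.2 x1) (sub_nonneg.2 y1)) (sub_nonneg.2 z1)
  -- the eight cells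
  cases bX <;> cases bY <;> cases bZ
  · -- (F,F,F): constant
    refine (bernsteinPos_const 3 hE3').congr fun h _ _ => ?_
    rw [sahiE_three, exc_or₃, exc_or₂, exc_or₂, exc_or₂, exc_or₁ μ h hμ1, exc_or₁ μ h hμ1, exc_or₁ μ h hμ1]
    simp only [cond_false]; ring
  · -- (F,F,T): affine, `Cov(X,Y)`
    refine ((bernsteinPos_affine hE3' hCXY).mono (by norm_num)).congr fun h _ _ => ?_
    rw [sahiE_three, exc_or₃, exc_or₂, exc_or₂, exc_or₂, exc_or₁ μ h hμ1, exc_or₁ μ h hμ1, exc_or₁ μ h hμ1]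
    simp only [cond_false, cond_true, mul_one]; ring
  · -- (F,T,F): affine, `Cov(X,Z)`
    refine ((bernsteinPos_affine hE3' hCXZ).mono (by norm_num)).congr fun h _ _ => ?_
    rw [sahiE_three, exc_or₃, exc_or₂, exc_or₂, exc_or₂, exc_or₁ μ h hμ1, exc_or₁ μ h hμ1, exc_or₁ μ h hμ1]
    simp only [cond_false, cond_true, mul_one, one_mul]; ring
  · -- (F,T,T): `g²E_3 + hg·T_X`
    refine (((bp_g2.smul hE3').add (bp_hg.smul hTX)).mono (by norm_num)).congr fun h _ _ => ?_
    rw [sahiE_three, exc_or₃, exc_or₂, exc_or₂, exc_or₂, exc_or₁ μ h hμ1, exc_or₁ μ h hμ1, exc_or₁ μ h hμ1]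
    simp only [cond_false, cond_true, mul_one, ex_one hμ1]; ring
  · -- (T,F,F): affine, `Cov(Y,Z)`
    refine ((bernsteinPos_affine hE3' hCYZ).mono (by norm_num)).congr fun h _ _ => ?_
    rw [sahiE_three, exc_or₃, exc_or₂, exc_or₂, exc_or₂, exc_or₁ μ h hμ1, exc_or₁ μ h hμ1, exc_or₁ μ h hμ1]
    simp only [cond_false, cond_true, one_mul]; ring
  · -- (T,F,T): `g²E_3 + hg·T_Y`
    refine (((bp_g2.smul hE3').add (bp_hg.smul hTY)).mono (by norm_num)).congr fun h _ _ => ?_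
    rw [sahiE_three, exc_or₃, exc_or₂, exc_or₂, exc_or₂, exc_or₁ μ h hμ1, exc_or₁ μ h hμ1, exc_or₁ μ h hμ1]
    simp only [cond_false, cond_true, mul_one, one_mul, ex_one hμ1]; ring
  · -- (T,T,F): `g²E_3 + hg·T_Z`
    refine (((bp_g2.smul hE3').add (bp_hg.smul hTZ)).mono (by norm_num)).congr fun h _ _ => ?_
    rw [sahiE_three, exc_or₃, exc_or₂, exc_or₂, exc_or₂, exc_or₁ μ h hμ1, exc_or₁ μ h hμ1, exc_or₁ μ h hμ1]
    simp only [cond_false, cond_true, mul_one, one_mul, ex_one hμ1]; ring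
  · -- (T,T,T): `g³E_3 + hg²(E_3 + a₁ + ∏(1−x_i)) + h²g·a₁`
    refine (((bp_g3.smul hE3').add (bp_hg2.smul (add_nonneg (add_nonneg hE3' hA1) hPN))).add (bp_h2g.smul hA1)).congr
      fun h _ _ => ?_
    rw [sahiE_three, exc_or₃, exc_or₂, exc_or₂, exc_or₂, exc_or₁ μ h hμ1, exc_or₁ μ h hμ1, exc_or₁ μ h hμ1]
    simp only [cond_true, mul_one, ex_one hμ1]; ring

omit hμ1 in
/-- **AND-mixture, triples**: `E_3` of the mixed triple is Bernstein-positive of degree `3`, for each of the eight mixing patterns. [this work] -/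
theorem bernsteinPos_three_andCoin (bX bY bZ : Bool) :
    BernsteinPos 3 (fun h => sahiE (coinWeight μ h) 3 ![ind (andCoin X bX), ind (andCoin Y bY), ind (andCoin Z bZ)]) := by
  have x0 : 0 ≤ ex μ (ind X) := ex_nonneg hμ (ind_nonneg X)
  have y0 : 0 ≤ ex μ (ind Y) := ex_nonneg hμ (ind_nonneg Y)
  have z0 : 0 ≤ ex μ (ind Z) := ex_nonneg hμ (ind_nonneg Z)
  have xy0 : 0 ≤ ex μ (ind X * ind Y) := ex_nonneg hμ fun a => mul_nonneg (ind_nonneg X a) (ind_nonneg Y a)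
  have xz0 : 0 ≤ ex μ (ind X * ind Z) := ex_nonneg hμ fun a => mul_nonneg (ind_nonneg X a) (ind_nonneg Z a)
  have yz0 : 0 ≤ ex μ (ind Y * ind Z) := ex_nonneg hμ fun a => mul_nonneg (ind_nonneg Y a) (ind_nonneg Z a)
  have xyz0 : 0 ≤ ex μ (ind X * ind Y * ind Z) :=
    ex_nonneg hμ fun a => mul_nonneg (mul_nonneg (ind_nonneg X a) (ind_nonneg Y a)) (ind_nonneg Z a)
  have hCXY : 0 ≤ ex μ (ind X * ind Y) - ex μ (ind X) * ex μ (ind Y) := sub_nonneg.2 hXY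
  have hCXZ : 0 ≤ ex μ (ind X * ind Z) - ex μ (ind X) * ex μ (ind Z) := sub_nonneg.2 hXZ
  have hCYZ : 0 ≤ ex μ (ind Y * ind Z) - ex μ (ind Y) * ex μ (ind Z) := sub_nonneg.2 hYZ
  have hE3' : 0 ≤ 2 * ex μ (ind X * ind Y * ind Z) + ex μ (ind X) * ex μ (ind Y) * ex μ (ind Z)
      - (ex μ (ind X) * ex μ (ind Y * ind Z) + ex μ (ind Y) * ex μ (ind X * ind Z) + ex μ (ind Z) * ex μ (ind X * ind Y)) := by
    rw [sahiE_three] at hE3; exact hE3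
  have hUZ : 0 ≤ (2 * ex μ (ind X * ind Y * ind Z) + ex μ (ind X) * ex μ (ind Y) * ex μ (ind Z)
      - (ex μ (ind X) * ex μ (ind Y * ind Z) + ex μ (ind Y) * ex μ (ind X * ind Z) + ex μ (ind Z) * ex μ (ind X * ind Y)))
      + ex μ (ind X) * (ex μ (ind Y * ind Z) - ex μ (ind Y) * ex μ (ind Z)) + ex μ (ind Y) * ex μ (ind X * ind Z) :=
    add_nonneg (add_nonneg hE3' (mul_nonneg x0 hCYZ)) (mul_nonneg y0 xz0)
  have hUY : 0 ≤ (2 * ex μ (ind X * ind Y * ind Z) + ex μ (ind X) * ex μ (ind Y) * ex μ (ind Z)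
      - (ex μ (ind X) * ex μ (ind Y * ind Z) + ex μ (ind Y) * ex μ (ind X * ind Z) + ex μ (ind Z) * ex μ (ind X * ind Y)))
      + ex μ (ind X) * (ex μ (ind Y * ind Z) - ex μ (ind Y) * ex μ (ind Z)) + ex μ (ind Z) * ex μ (ind X * ind Y) :=
    add_nonneg (add_nonneg hE3' (mul_nonneg x0 hCYZ)) (mul_nonneg z0 xy0)
  have hUX : 0 ≤ (2 * ex μ (ind X * ind Y * ind Z) + ex μ (ind X) * ex μ (ind Y) * ex μ (ind Z)
      - (ex μ (ind X) * ex μ (ind Y * ind Z) + ex μ (ind Y) * ex μ (ind X * ind Z) + ex μ (ind Z) * ex μ (ind X * ind Y)))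
      + ex μ (ind Y) * (ex μ (ind X * ind Z) - ex μ (ind X) * ex μ (ind Z)) + ex μ (ind Z) * ex μ (ind X * ind Y) :=
    add_nonneg (add_nonneg hE3' (mul_nonneg y0 hCXZ)) (mul_nonneg z0 xy0)
  have hC2 : 0 ≤ 2 * (2 * ex μ (ind X * ind Y * ind Z) + ex μ (ind X) * ex μ (ind Y) * ex μ (ind Z)
      - (ex μ (ind X) * ex μ (ind Y * ind Z) + ex μ (ind Y) * ex μ (ind X * ind Z) + ex μ (ind Z) * ex μ (ind X * ind Y)))
      + ex μ (ind X) * (ex μ (ind Y * ind Z) - ex μ (ind Y) * ex μ (ind Z))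
      + ex μ (ind Y) * (ex μ (ind X * ind Z) - ex μ (ind X) * ex μ (ind Z))
      + ex μ (ind Z) * (ex μ (ind X * ind Y) - ex μ (ind X) * ex μ (ind Y))
      + ex μ (ind X) * ex μ (ind Y) * ex μ (ind Z) :=
    add_nonneg (add_nonneg (add_nonneg (add_nonneg (mul_nonneg zero_le_two hE3') (mul_nonneg x0 hCYZ)) (mul_nonneg y0 hCXZ))
      (mul_nonneg z0 hCXY)) (mul_nonneg (mul_nonneg x0 y0) z0)
  cases bX <;> cases bY <;> cases bZ
  · -- (F,F,F): constant
    refine (bernsteinPos_const 3 hE3').congr fun h _ _ => ?_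
    rw [sahiE_three, exc_and₃, exc_and₂, exc_and₂, exc_and₂, exc_and₁, exc_and₁, exc_and₁]
    simp only [cond_false]; ring
  · -- (F,F,T): `h·E_3`
    refine ((bernsteinPos_affine le_rfl hE3').mono (by norm_num)).congr fun h _ _ => ?_
    rw [sahiE_three, exc_and₃, exc_and₂, exc_and₂, exc_and₂, exc_and₁, exc_and₁, exc_and₁]
    simp only [cond_false, cond_true, mul_zero, ex_zero_fun]; ring
  · -- (F,T,F)
    refine ((bernsteinPos_affine le_rfl hE3').mono (by norm_num)).congr fun h _ _ => ?_
    rw [sahiE_three, exc_and₃, exc_and₂, exc_and₂, exc_and₂, exc_and₁, exc_and₁, exc_and₁]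
    simp only [cond_false, cond_true, mul_zero, zero_mul, ex_zero_fun]; ring
  · -- (F,T,T): `hg·U_X + h²·E_3`
    refine (((bp_hg.smul hUX).add (bp_h2.smul hE3')).mono (by norm_num)).congr fun h _ _ => ?_
    rw [sahiE_three, exc_and₃, exc_and₂, exc_and₂, exc_and₂, exc_and₁, exc_and₁, exc_and₁]
    simp only [cond_false, cond_true, mul_zero, ex_zero_fun]; ring
  · -- (T,F,F)
    refine ((bernsteinPos_affine le_rfl hE3').mono (by norm_num)).congr fun h _ _ => ?_
    rw [sahiE_three, exc_and₃, exc_and₂, exc_and₂, exc_and₂, exc_and₁, exc_and₁, exc_and₁]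
    simp only [cond_false, cond_true, zero_mul, ex_zero_fun]; ring
  · -- (T,F,T): `hg·U_Y + h²·E_3`
    refine (((bp_hg.smul hUY).add (bp_h2.smul hE3')).mono (by norm_num)).congr fun h _ _ => ?_
    rw [sahiE_three, exc_and₃, exc_and₂, exc_and₂, exc_and₂, exc_and₁, exc_and₁, exc_and₁]
    simp only [cond_false, cond_true, mul_zero, zero_mul, ex_zero_fun]; ring
  · -- (T,T,F): `hg·U_Z + h²·E_3`
    refine (((bp_hg.smul hUZ).add (bp_h2.smul hE3')).mono (by norm_num)).congr fun h _ _ => ?_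
    rw [sahiE_three, exc_and₃, exc_and₂, exc_and₂, exc_and₂, exc_and₁, exc_and₁, exc_and₁]
    simp only [cond_false, cond_true, mul_zero, zero_mul, ex_zero_fun]; ring
  · -- (T,T,T): `2hg²·x_{012} + h²g·c₂ + h³·E_3`
    refine (((bp_hg2.smul (mul_nonneg zero_le_two xyz0)).add (bp_h2g.smul hC2)).add (bp_h3.smul hE3')).congr
      fun h _ _ => ?_
    rw [sahiE_three, exc_and₃, exc_and₂, exc_and₂, exc_and₂, exc_and₁, exc_and₁, exc_and₁]
    simp only [cond_true, mul_zero, ex_zero_fun]; ring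

end Triple

end SahiMixture

end Summit.CriticalPhenomena.PercolationContinuityZ3.Theorems

end
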